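import Summits.CriticalPhenomena.PercolationContinuityZ3.Theorems.PercNearOneGluingNoHeavyLowerTailSunflowerRainbowDichotomy
import HarnessLib
import HarnessLib.Audit

/-!
# `NoHeavyLowerTail` (crux stmt-CriticalPhenomena-4575), abstract sunflower cubic: REFUTATION of the partial-order rainbow dichotomy
# `RainbowDichotomy` (gen 22, `…SunflowerRainbowDichotomy`) by a six-point sunflower with twins

Support file (seat `prim-l12-p2` gen 22; `--supports stmt-CriticalPhenomena-4575`).  No `sorry`, no new definitions (two local notations
abbreviate the witness); the sunflower axiom, the three rainbow memberships and the two vector identities are evaluated by the kernel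
(`decide +kernel`, one declaration each, ≈ 2–3 min in total).  The repaired (linear-extension) form of the dichotomy is
`RainbowLinearDichotomy` (`…SunflowerRainbowLinearDichotomy`).  Memo: run/shared/lean/prim/prim-l12/prim-l12-p2/FINDING-g22-RAINBOW-DICHOTOMY.md §1.

THE WITNESS (ground set `Fin 6`).  `V 0 = ↑{0,1} ∪ ↑{5}`, `V 1 = ↑{0,2} ∪ ↑{0,3} ∪ ↑{0,4} ∪ ↑{1,2,5} ∪ ↑{1,3,5} ∪ ↑{2,3,5} ∪ ↑{4,5}`,
`V 2 = ↑{1,2} ∪ ↑{1,3} ∪ ↑{1,4} ∪ ↑{0,2,5} ∪ ↑{0,3,5} ∪ ↑{2,3,5} ∪ ↑{4,5}` (all pairwise intersections equal; the elements `2, 3` are twins).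
Rainbows `ρ₁ = ({2,5},{0,3},{1,4})`, `ρ₂ = ({3,5},{0,2},{1,4})` (`RbBelow`-incomparable) and `ρ₀ = ({5},{0,2,3},{1,4})` (strictly below both):
`TS-B ρ₁ = TS-B ρ₀ + TS-B ρ₂` — so `DepB ρ₁`, neither `ρ₀` nor `ρ₂` being strictly above `ρ₁` — and `TS-A ρ₁ = TS-A ρ₂` — so `DepA ρ₁`,
`ρ₂` not being strictly below `ρ₁`.  Hence `¬ RainbowDichotomy`.  (`RainbowKernelIndependence` holds for this sunflower — the ten full
vectors have rank ten —, and along every TOTAL order one twin precedes the other, so the linear-extension dichotomy survives.)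

* `Sunflower.depB_of_eq_add`, `Sunflower.depA_of_eq` — bookkeeping: a two-term (one-term) relation with admissible partners gives `DepB` (`DepA`);
* `zzWitness_upper`, `zzWitness_inter`, `zzWitness_mem₁/₀/₂`, `zzWitness_tsB`, `zzWitness_tsA` — the kernel evaluations;
* `exists_rainbowDichotomy_witness`, **`not_rainbowDichotomy`**.
-/

namespace Summit.CriticalPhenomena.PercolationContinuityZ3.Theorems.SunflowerPartition

open Finset

namespace Sunflower

variable {α : Type*} [Fintype α] [DecidableEq α] (F : Sunflower α)

/-- `DepB ρ` from a two-term relation `TS-B ρ = TS-B ρa + TS-B ρb` with rainbows `ρa, ρb ≠ ρ` not strictly above `ρ`. [this work] -/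
theorem depB_of_eq_add {ρ ρa ρb : Finset α × Finset α} (ha : ρa ∈ F.rainbows) (hb : ρb ∈ F.rainbows)
    (hna : ρa ≠ ρ) (hnb : ρb ≠ ρ) (hra : ¬ RbBelow ρ ρa) (hrb : ¬ RbBelow ρ ρb)
    (e : F.tsB ρ = F.tsB ρa + F.tsB ρb) : F.DepB ρ := by
  unfold DepB
  rw [e]
  exact Submodule.add_mem _ (Submodule.subset_span ⟨ρa, ⟨ha, hna, hra⟩, rfl⟩)
    (Submodule.subset_span ⟨ρb, ⟨hb, hnb, hrb⟩, rfl⟩)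

/-- `DepA ρ` from a one-term relation `TS-A ρ = TS-A ρb` with a rainbow `ρb ≠ ρ` not strictly below `ρ`. [this work] -/
theorem depA_of_eq {ρ ρb : Finset α × Finset α} (hb : ρb ∈ F.rainbows) (hnb : ρb ≠ ρ) (hrb : ¬ RbBelow ρb ρ)
    (e : F.tsA ρ = F.tsA ρb) : F.DepA ρ := by
  unfold DepA
  rw [e]
  exact Submodule.subset_span ⟨ρb, ⟨hb, hnb, hrb⟩, rfl⟩

end Sunflower

/-! ## The witness (local notations, no definitions) -/

set_option quotPrecheck false in
/-- The three up-sets of the witness, by their generators (a local notation, not a definition). -/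
local notation "zzV" => (fun i : Fin 3 => Finset.univ.filter fun S : Finset (Fin 6) =>
    ∃ g ∈ (![({ {0,1}, {5} } : Finset (Finset (Fin 6))),
            ({ {0,2}, {0,3}, {0,4}, {1,2,5}, {1,3,5}, {2,3,5}, {4,5} } : Finset (Finset (Fin 6))),
            ({ {1,2}, {1,3}, {1,4}, {0,2,5}, {0,3,5}, {2,3,5}, {4,5} } : Finset (Finset (Fin 6)))] : Fin 3 → Finset (Finset (Fin 6))) i,
      g ⊆ S)

/-- The witness' `V i` are up-sets. [this work] -/
theorem zzWitness_upper : ∀ i : Fin 3, IsUpperSet ((zzV i : Finset (Finset (Fin 6))) : Set (Finset (Fin 6))) := by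
  intro i S T hST hS
  simp only [coe_filter, mem_univ, true_and, Set.mem_setOf_eq] at hS ⊢
  obtain ⟨g, hg, hgS⟩ := hS
  exact ⟨g, hg, hgS.trans hST⟩

/-- The witness' `V i` have a common pairwise intersection (kernel evaluation). [this work] -/
theorem zzWitness_inter : ∀ i j : Fin 3, i ≠ j → zzV i ∩ zzV j = zzV 0 ∩ zzV 1 := by
  decide +kernel

set_option quotPrecheck false in
/-- The witness sunflower (a local notation, not a definition). -/
local notation "zzF" => (⟨zzV, zzWitness_upper, zzWitness_inter⟩ : Sunflower (Fin 6))

/-- `ρ₁ = ({2,5},{0,3},{1,4})` is a rainbow of the witness (kernel evaluation). [this work] -/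
theorem zzWitness_mem₁ : (({2,5}, {0,3}) : Finset (Fin 6) × Finset (Fin 6)) ∈ (zzF).rainbows := by
  decide +kernel

/-- `ρ₀ = ({5},{0,2,3},{1,4})` is a rainbow of the witness (kernel evaluation). [this work] -/
theorem zzWitness_mem₀ : (({5}, {0,2,3}) : Finset (Fin 6) × Finset (Fin 6)) ∈ (zzF).rainbows := by
  decide +kernel

/-- `ρ₂ = ({3,5},{0,2},{1,4})` is a rainbow of the witness (kernel evaluation). [this work] -/
theorem zzWitness_mem₂ : (({3,5}, {0,2}) : Finset (Fin 6) × Finset (Fin 6)) ∈ (zzF).rainbows := by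
  decide +kernel

/-- `TS-B ρ₁ = TS-B ρ₀ + TS-B ρ₂` in the witness (kernel evaluation). [this work] -/
theorem zzWitness_tsB : (zzF).tsB (({2,5}, {0,3}) : Finset (Fin 6) × Finset (Fin 6))
    = (zzF).tsB ({5}, {0,2,3}) + (zzF).tsB ({3,5}, {0,2}) := by
  decide +kernel

/-- `TS-A ρ₁ = TS-A ρ₂` in the witness (kernel evaluation). [this work] -/
theorem zzWitness_tsA : (zzF).tsA (({2,5}, {0,3}) : Finset (Fin 6) × Finset (Fin 6)) = (zzF).tsA ({3,5}, {0,2}) := by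
  decide +kernel

set_option maxRecDepth 4096 in
/-- **The witness**: a sunflower on `Fin 6` with a rainbow that is both `DepB` and `DepA`.  (`maxRecDepth` is raised only for the
elaborator's traversal of the large explicit structure term; no heartbeat option is touched.) [this work] -/
theorem exists_rainbowDichotomy_witness : ∃ F : Sunflower (Fin 6), ∃ ρ ∈ F.rainbows, F.DepB ρ ∧ F.DepA ρ := by
  refine ⟨zzF, ({2,5}, {0,3}), zzWitness_mem₁, ?_, ?_⟩
  · exact @Sunflower.depB_of_eq_add (Fin 6) _ _ zzF ({2,5}, {0,3}) ({5}, {0,2,3}) ({3,5}, {0,2})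
      zzWitness_mem₀ zzWitness_mem₂ (by decide +kernel) (by decide +kernel)
      (by unfold RbBelow; decide +kernel) (by unfold RbBelow; decide +kernel) zzWitness_tsB
  · exact @Sunflower.depA_of_eq (Fin 6) _ _ zzF ({2,5}, {0,3}) ({3,5}, {0,2})
      zzWitness_mem₂ (by decide +kernel) (by unfold RbBelow; decide +kernel) zzWitness_tsA

set_option maxRecDepth 4096 in
/-- **`RainbowDichotomy` is false** (this work). [this work] -/
theorem not_rainbowDichotomy : ¬ RainbowDichotomy := fun h =>
  exists_rainbowDichotomy_witness.elim fun F hF => hF.elim fun ρ hρ => h (Fin 6) F ρ hρ.1 hρ.2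

end Summit.CriticalPhenomena.PercolationContinuityZ3.Theorems.SunflowerPartition
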